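import Literature.Analysis.OperatorTheory.YangMillsMatrixModelMinMax
import Literature.Analysis.OperatorTheory.YangMillsMatrixModelLuscherSimonGapHolds
import HarnessLib

/-!
# Route `LuscherReduction`, item `DressedRitz` (stmt-QuantumFields-20205), line «polyakovlift», stub S-PSCAL″ — SPECTRAL CLUSTER WINDOWS of Lüscher's matrix
# Hamiltonian (F9 assembly, layer D1a; LEAD prover ym-lead-20205-polyakovlift g2)

Pure combinatorics of the monotone unbounded sequence of invariant levels `E_j := physLevel (j+1)` (tree: `physLevel_mono`, `tendsto_physLevel_atTop`).
The spectral index `j` (the `j`-th one-site transfer level `λ_j(B) ≍ ν e^{−λ_b E_j}`, crux ONE) belongs to the CLUSTER WINDOW `[winLo j, winHi j)` of indices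
carrying the same level:

* `idxLevel j = physLevel (j+1)`, `idxLevel_mono`, `exists_idxLevel_lt`;
* `winLo j` / `winHi j` — first index of the cluster of `j` / first index beyond it; `lt_winLo_iff : m < winLo j ↔ E_m < E_j`, `lt_winHi_iff : m < winHi j ↔ E_m ≤ E_j`,
  `winLo_le`, `lt_winHi`, `winLo_mono`, `winLo_lt_winLo_iff`, `winLo_le_winLo_iff` (the cluster LABEL `winLo` is monotone and separates clusters exactly as
  `ClusterInd.cluster_induction` wants), `idxLevel_winHi`, `idxLevel_eq_of_mem_window`;
* `exists_clusterEnd k` — an index `K ≥ k` closing its cluster (`E_K < E_{K+1}`); `winHi_le_of_clusterEnd` — all windows of indices `≤ K` lie in `[0, K+1)`.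

HONEST FRAMING: bookkeeping; nothing here bears on infinite volume, the continuum limit or the Clay gap.
References: Reed–Simon IV, Thm. XIII.1 [cite: ReedSimonIV1978, Thm. XIII.1]; B. Simon, Ann. Phys. 146 (1983) 209 [cite: SimonB1983DiscreteSpectrum, Cor. 4].
-/

set_option autoImplicit false

noncomputable section

open Filter Topology
open scoped Classical

namespace Summit.QuantumFields.YangMills.Theorems.FemtoTransferGap.PScal

open Literature.Analysis.OperatorTheory.YMMatrixModel

/-- The level carried by the spectral index `j`: `E_j = physLevel (j+1)`. [cite: ReedSimonIV1978, Thm. XIII.1] -/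
def idxLevel (j : ℕ) : ℝ := physLevel (j + 1)

/-- `idxLevel` unfolded. [folklore] -/
theorem idxLevel_eq (j : ℕ) : idxLevel j = physLevel (j + 1) := rfl

/-- `E_j` is monotone in the index. [cite: ReedSimonIV1978, Thm. XIII.1] -/
theorem idxLevel_mono : Monotone idxLevel := fun _ _ h => physLevel_mono (by omega) (by omega)

/-- Every level is eventually exceeded (discreteness of the invariant spectrum). [cite: SimonB1983DiscreteSpectrum, Cor. 4] -/
theorem exists_idxLevel_lt (j : ℕ) : ∃ m, idxLevel j < idxLevel m := by
  have h : Tendsto (fun n : ℕ => physLevel (n + 1)) atTop atTop := tendsto_physLevel_atTop.comp (tendsto_add_atTop_nat 1)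
  obtain ⟨m, hm⟩ := (tendsto_atTop_atTop.1 h) (idxLevel j + 1)
  exact ⟨m, by have := hm m le_rfl; rw [idxLevel_eq] at this ⊢; simp only [idxLevel] at *; linarith⟩

/-- A trivial witness: the level of `j` is reached at `j`. [folklore] -/
theorem exists_idxLevel_le (j : ℕ) : ∃ m, idxLevel j ≤ idxLevel m := ⟨j, le_rfl⟩

/-- First index of the cluster of `j`. [cite: ReedSimonIV1978, Thm. XIII.1] -/
def winLo (j : ℕ) : ℕ := Nat.find (exists_idxLevel_le j)

/-- First index beyond the cluster of `j`. [cite: ReedSimonIV1978, Thm. XIII.1] -/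
def winHi (j : ℕ) : ℕ := Nat.find (exists_idxLevel_lt j)

/-- `m < winLo j ↔ E_m < E_j`. [folklore] -/
theorem lt_winLo_iff {j m : ℕ} : m < winLo j ↔ idxLevel m < idxLevel j := by
  rw [winLo, Nat.lt_find_iff]
  constructor
  · intro h; exact lt_of_not_ge (h m le_rfl)
  · intro h m' hm' hle; exact absurd (hle.trans (idxLevel_mono hm')) (not_le.2 h)

/-- `m < winHi j ↔ E_m ≤ E_j`. [folklore] -/
theorem lt_winHi_iff {j m : ℕ} : m < winHi j ↔ idxLevel m ≤ idxLevel j := by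
  rw [winHi, Nat.lt_find_iff]
  constructor
  · intro h; exact le_of_not_gt (h m le_rfl)
  · intro h m' hm' hlt; exact absurd (hlt.trans_le ((idxLevel_mono hm').trans h)) (lt_irrefl _)

/-- `winLo j ≤ j`. [folklore] -/
theorem winLo_le (j : ℕ) : winLo j ≤ j := Nat.find_le le_rfl

/-- `j < winHi j`. [folklore] -/
theorem lt_winHi (j : ℕ) : j < winHi j := lt_winHi_iff.2 le_rfl

/-- `winLo j < winHi j`. [folklore] -/
theorem winLo_lt_winHi (j : ℕ) : winLo j < winHi j := (winLo_le j).trans_lt (lt_winHi j)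

/-- The level jumps at `winHi j`: `E_j < E_{winHi j}`. [folklore] -/
theorem idxLevel_winHi (j : ℕ) : idxLevel j < idxLevel (winHi j) := Nat.find_spec (exists_idxLevel_lt j)

/-- `E_{winLo j} = E_j`. [folklore] -/
theorem idxLevel_winLo (j : ℕ) : idxLevel (winLo j) = idxLevel j :=
  le_antisymm (idxLevel_mono (winLo_le j)) (Nat.find_spec (exists_idxLevel_le j))

/-- Inside the window the level is constant. [folklore] -/
theorem idxLevel_eq_of_mem_window {j m : ℕ} (h1 : winLo j ≤ m) (h2 : m < winHi j) : idxLevel m = idxLevel j :=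
  le_antisymm (lt_winHi_iff.1 h2) ((idxLevel_winLo j).symm.le.trans (idxLevel_mono h1))

/-- The cluster label `winLo` is monotone. [folklore] -/
theorem winLo_mono : Monotone winLo := by
  intro j j' h
  by_contra hc
  push Not at hc
  have h1 : idxLevel (winLo j') < idxLevel j := lt_winLo_iff.1 hc
  have h2 : idxLevel j ≤ idxLevel j' := idxLevel_mono h
  have h3 : idxLevel (winLo j') = idxLevel j' := idxLevel_winLo j'
  linarith

/-- `winLo j′ < winLo j ↔ E_{j′} < E_j` (`↔ j′ < winLo j`). [folklore] -/
theorem winLo_lt_winLo_iff {j j' : ℕ} : winLo j' < winLo j ↔ idxLevel j' < idxLevel j := by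
  constructor
  · intro h
    by_contra hc
    push Not at hc
    have := lt_winLo_iff.1 h
    rw [idxLevel_winLo] at this
    linarith
  · intro h
    exact lt_of_le_of_lt (winLo_le j') (lt_winLo_iff.2 h)

/-- `winLo j′ ≤ winLo j ↔ E_{j′} ≤ E_j` (`↔ j′ < winHi j`). [folklore] -/
theorem winLo_le_winLo_iff {j j' : ℕ} : winLo j' ≤ winLo j ↔ idxLevel j' ≤ idxLevel j := by
  rw [← not_lt, winLo_lt_winLo_iff, not_lt]

/-- The label test of the cluster induction, strict form: `winLo j′ < winLo j ↔ j′ < winLo j`. [folklore] -/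
theorem winLo_lt_winLo_iff_lt {j j' : ℕ} : winLo j' < winLo j ↔ j' < winLo j := by
  rw [winLo_lt_winLo_iff, lt_winLo_iff]

/-- The label test of the cluster induction, weak form: `winLo j′ ≤ winLo j ↔ j′ < winHi j`. [folklore] -/
theorem winLo_le_winLo_iff_lt {j j' : ℕ} : winLo j' ≤ winLo j ↔ j' < winHi j := by
  rw [winLo_le_winLo_iff, lt_winHi_iff]

/-- Two indices have equal labels iff they lie in each other's window. [folklore] -/
theorem winLo_eq_winLo_iff {j j' : ℕ} : winLo j' = winLo j ↔ winLo j ≤ j' ∧ j' < winHi j := by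
  rw [le_antisymm_iff, winLo_le_winLo_iff_lt, winLo_le_winLo_iff, ← not_lt, ← lt_winLo_iff, not_lt]
  exact and_comm

/-- Windows of indices with the same label coincide. [folklore] -/
theorem window_eq_of_winLo_eq {j j' : ℕ} (h : winLo j' = winLo j) : winHi j' = winHi j := by
  have hE : idxLevel j' = idxLevel j := by rw [← idxLevel_winLo j', h, idxLevel_winLo]
  apply le_antisymm
  · by_contra hc; push Not at hc
    have := lt_winHi_iff.1 hc
    have h2 := idxLevel_winHi j
    linarith
  · by_contra hc; push Not at hc
    have := lt_winHi_iff.1 hc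
    have h2 := idxLevel_winHi j'
    linarith

/-- Every index is followed by a CLUSTER END `K ≥ k` (`E_K < E_{K+1}`). [cite: SimonB1983DiscreteSpectrum, Cor. 4] -/
theorem exists_clusterEnd (k : ℕ) : ∃ K : ℕ, k ≤ K ∧ idxLevel K < idxLevel (K + 1) := by
  have hk : k < winHi k := lt_winHi k
  refine ⟨winHi k - 1, by omega, ?_⟩
  have e : winHi k - 1 + 1 = winHi k := by omega
  rw [e]
  have h1 : idxLevel (winHi k - 1) ≤ idxLevel k := lt_winHi_iff.1 (by omega)
  exact lt_of_le_of_lt h1 (idxLevel_winHi k)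

/-- Below a cluster end all windows end by `K + 1`. [folklore] -/
theorem winHi_le_of_clusterEnd {K j : ℕ} (hK : idxLevel K < idxLevel (K + 1)) (hj : j ≤ K) : winHi j ≤ K + 1 := by
  by_contra hc
  push Not at hc
  have h1 : idxLevel (K + 1) ≤ idxLevel j := lt_winHi_iff.1 hc
  have h2 : idxLevel j ≤ idxLevel K := idxLevel_mono hj
  linarith

/-- The ground cluster is the single index `0` (simplicity of the invariant ground state, `physLevel 1 < physLevel 2`): `winHi 0 = 1`.
[cite: ReedSimonIV1978, Thm. XIII.47] -/
theorem winHi_zero : winHi 0 = 1 := by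
  apply le_antisymm
  · by_contra hc; push Not at hc
    have h := lt_winHi_iff.1 hc
    have h2 := physLevel_one_lt_physLevel_two
    simp only [idxLevel] at h
    norm_num at h
    linarith
  · exact lt_winHi 0

/-- For `j ≥ 1` the window of `j` starts at an index `≥ 1` (the ground cluster is `{0}`). [cite: ReedSimonIV1978, Thm. XIII.47] -/
theorem one_le_winLo {j : ℕ} (hj : 1 ≤ j) : 1 ≤ winLo j := by
  by_contra hc
  push Not at hc
  have h0 : winLo j = 0 := by omega
  have h1 : idxLevel 0 = idxLevel j := by rw [← idxLevel_winLo j, h0]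
  have h2 : j < winHi 0 := lt_winHi_iff.2 h1.symm.le
  rw [winHi_zero] at h2
  omega

end Summit.QuantumFields.YangMills.Theorems.FemtoTransferGap.PScal

end
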